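import Summits.AtomisticToContinuum.HydrodynamicLimit.Theorems.LambertianContactSwapCollisionMomentBoundRung0
import HarnessLib

/-!
# `LambertianContactSwap.CollisionMomentBound` (stmt-AtomisticToContinuum-12102): the evolved shell bound HOLDS
# at rung 0 (its hypothesis is satisfiable, with constants uniform in `N`)

Helper file (`--supports stmt-AtomisticToContinuum-12102`).  The reduction
`collisionMomentBound_of_shellFluxBound` (`…CollisionMomentBoundShellReduction`) derives the item from an
`O(ε_N² h) + O(h²)` bound, uniform in `N`, for the `(1+|g|³)`-weighted probability under the EVOLVED local Gibbs law
that one pair of spheres is within `h|g|` of contact.  This file proves that hypothesis for CONSTANT profiles (the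
flow-invariant homogeneous Gibbs law), with explicit constants — so the hypothesis of the reduction is non-vacuous
and correctly scaled:

* `volume_annulus_le`, `volume_torusAnnulus_le` — `vol{q ∈ ℝ³ : ε ≤ ‖q‖ ≤ R} ≤ (R³ − ε³) · vol B₁`, and the same
  for the minimal-image annulus on `𝕋³` (Haar versus Lebesgue through the minimal image);
* `lintegral_annulusIndicator_le` — STATICS at rung 0: under `G_N = localGibbsLaw σ a u θ N Φ` (product of the
  configurational Gibbs measure and Gaussians, `localGibbsMeasure_rung0_eq_map`), for a pair `i ≠ j` whose
  canonical pair law is `≤ 4 ×` Haar (`hpair`, Ruelle bound) and any measurable radius `r(vᵢ, vⱼ) ≥ ε` and weight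
  `A(vᵢ, vⱼ)`: `∫ 𝟙{ε ≤ ‖xᵢ − xⱼ‖_{𝕋³} ≤ r(vᵢ,vⱼ)} A(vᵢ,vⱼ) dG_N ≤ 4 vol B₁ ∫ (r³ − ε³) A d(N(u,θ) ⊗ N(u,θ))`;
* `cube_sub_cube_mul_le` — `((ε + h g)³ − ε³)(1 + g³) ≤ ε² h · 3g(1+g³) + h² · 8(1+g⁶)` (`ε, h ≤ 1`, `g ≥ 0`), and
  the finiteness of the Gaussian moments involved (`lintegral_sexticMoment_ne_top`, `…cubicFluxMoment3_ne_top`);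
* `shellFluxBound_const` — for `a, θ > 0`, `u`: `∃ σ₀ > 0 ∀ 0 < σ < σ₀ ∀ Φ ∃ A ∀ N ∃ B ∀ h ∈ (0,1] ∀ s ∀ i ≠ j`,
  `∫ 𝟙{‖xᵢ − xⱼ‖_{𝕋³} ≤ ε_N + h‖vᵢ − vⱼ‖}(Φ_s z) (1 + ‖vᵢ − vⱼ‖³)(Φ_s z) dG_N(z) ≤ A ε_N² h + B h²`
  — the hypothesis of `collisionMomentBound_of_shellFluxBound` for constant profiles, with `A`, `B` independent of
  `N` (and of `σ`): invariance of `G_N` under `Φ_s` (`measurePreserving_flow_localGibbsLaw_const`), `G_N`-a.e.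
  non-overlap (so the shell is the annulus `ε_N ≤ ‖xᵢ − xⱼ‖ ≤ ε_N + h|g|`), the static bound, and the polynomial
  and moment estimates.

References: Cercignani–Illner–Pulvirenti 1994 App. 4.A; Ruelle 1969 §4 (low-density correlation bounds).
-/

noncomputable section

open MeasureTheory Set Filter Topology
open scoped ENNReal InnerProductSpace BigOperators Classical

namespace Summit.AtomisticToContinuum.HydrodynamicLimit.Theorems.LambertianContactSwapCollisionMomentBound

open Literature.Analysis.FluidPDE Literature.Analysis.FunctionSpaces
  Literature.MathematicalPhysics.KineticTheory

/-! ### Volumes of annuli -/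

/-- `vol{q ∈ ℝ³ : ε ≤ ‖q‖ ≤ R} ≤ (R³ − ε³) · vol(B(0,1))` for `0 ≤ ε ≤ R` (Haar scaling of balls). [folklore] -/
theorem volume_annulus_le {ε R : ℝ} (hε : 0 ≤ ε) (hεR : ε ≤ R) :
    volume {q : V3 | ε ≤ ‖q‖ ∧ ‖q‖ ≤ R} ≤
      ENNReal.ofReal (R ^ 3 - ε ^ 3) * volume (Metric.ball (0 : V3) 1) := by
  have hsub : {q : V3 | ε ≤ ‖q‖ ∧ ‖q‖ ≤ R} ⊆ Metric.closedBall (0 : V3) R \ Metric.ball 0 ε := by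
    intro q hq
    simp only [Set.mem_sdiff, Metric.mem_closedBall, dist_zero_right, Metric.mem_ball, not_lt]
    exact ⟨hq.2, hq.1⟩
  refine (measure_mono hsub).trans (le_of_eq ?_)
  rw [measure_sdiff (Metric.ball_subset_closedBall.trans (Metric.closedBall_subset_closedBall hεR))
      measurableSet_ball.nullMeasurableSet measure_ball_lt_top.ne,
    Measure.addHaar_closedBall volume _ (hε.trans hεR), Measure.addHaar_ball volume _ hε,
    finrank_euclideanSpace_fin, ← ENNReal.sub_mul fun _ _ => measure_ball_lt_top.ne,
    ← ENNReal.ofReal_sub _ (pow_nonneg hε 3)]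

/-- The minimal-image annulus on `𝕋³` has Haar measure at most that of the Euclidean annulus:
`vol{p ∈ 𝕋³ : ε ≤ ‖reprSym p‖ ≤ R} ≤ (R³ − ε³) · vol(B(0,1))`. [folklore] -/
theorem volume_torusAnnulus_le {ε R : ℝ} (hε : 0 ≤ ε) (hεR : ε ≤ R) :
    volume {p : T3 | ε ≤ ‖Torus.reprSym p‖ ∧ ‖Torus.reprSym p‖ ≤ R} ≤
      ENNReal.ofReal (R ^ 3 - ε ^ 3) * volume (Metric.ball (0 : V3) 1) := by
  have hBm : MeasurableSet {q : V3 | ε ≤ ‖q‖ ∧ ‖q‖ ≤ R} :=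
    (measurableSet_le measurable_const measurable_norm).inter
      (measurableSet_le measurable_norm measurable_const)
  have hsub : {p : T3 | ε ≤ ‖Torus.reprSym p‖ ∧ ‖Torus.reprSym p‖ ≤ R} ⊆
      {x : T3 | ∃ k : Fin 3 → ℤ, Torus.reprSym (x - 0) + Torus.latticeVec k ∈
        {q : V3 | ε ≤ ‖q‖ ∧ ‖q‖ ≤ R}} := by
    intro p hp
    refine ⟨0, ?_⟩
    rw [Torus.latticeVec_zero, add_zero, sub_zero]
    exact hp
  exact (measure_mono hsub).trans
    ((volume_setOf_exists_reprSym_add_latticeVec_mem_le 0 hBm).trans (volume_annulus_le hε hεR))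

/-! ### Statics at rung 0: the annulus event of one pair under the homogeneous Gibbs law -/

/-- **The weighted annulus event of one pair under the homogeneous Gibbs law.** For `σ ≤ 1/2`, constant profiles
`a, θ > 0`, `u`, a pair `i ≠ j` of the `N + 1` spheres whose canonical pair law is at most `4 ×` Haar measure
(`hpair`), a measurable radius `r(vᵢ, vⱼ) ≥ ε = hsDiameter σ N` and a measurable weight `A(vᵢ, vⱼ)`:
`∫ 𝟙{ε ≤ ‖xᵢ − xⱼ‖_{𝕋³} ≤ r(vᵢ, vⱼ)} A(vᵢ, vⱼ) dG_N ≤ 4 vol(B₁) · ∫ (r(p)³ − ε³) A(p) d(N(u,θ) ⊗ N(u,θ))(p)`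
(disintegration of `G_N = posGibbs ⊗ N(u,θ)^{⊗(N+1)}`, the pair bound, and the annulus volume). [folklore] -/
theorem lintegral_annulusIndicator_le {σ : ℝ} (hσ2 : σ ≤ 1 / 2) (hσ0 : 0 ≤ σ) {a θ : ℝ} (ha : 0 < a)
    (hθ : 0 < θ) (u : V3) {N : ℕ} {i j : Fin (N + 1)} (hij : i ≠ j)
    (hpair : ∀ T : Set T3, MeasurableSet T →
      posGibbsMeasure (fun _ : T3 => (1 : ℝ)) (hsDiameter σ N) (N + 1) {x | x i - x j ∈ T} ≤ 4 * volume T)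
    (Φ : HardSphereFlow (Torus.geometry (Fin 3)) (hsDiameter σ N) (N + 1)) {r : V3 × V3 → ℝ}
    (hrm : Measurable r) (hr : ∀ p, hsDiameter σ N ≤ r p) {A : V3 × V3 → ℝ≥0∞} (hA : Measurable A) :
    ∫⁻ w, {w : Config (N + 1) (Fin 3) T3 |
        hsDiameter σ N ≤ ‖(Torus.geometry (Fin 3)).sepVec (w i).1 (w j).1‖ ∧
          ‖(Torus.geometry (Fin 3)).sepVec (w i).1 (w j).1‖ ≤ r ((w i).2, (w j).2)}.indicator
        (fun w => A ((w i).2, (w j).2)) w ∂(localGibbsLaw σ (fun _ => a) (fun _ => u) (fun _ => θ) N Φ) ≤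
      4 * volume (Metric.ball (0 : V3) 1) *
        ∫⁻ p, ENNReal.ofReal (r p ^ 3 - hsDiameter σ N ^ 3) * A p
          ∂((gaussMeasure u θ).prod (gaussMeasure u θ)) := by
  set ε := hsDiameter σ N with hεdef
  have hε0 : 0 ≤ ε := by rw [hεdef, hsDiameter]; positivity
  set c : ℝ≥0∞ := volume (Metric.ball (0 : V3) 1) with hc
  have hctop : c ≠ ⊤ := measure_ball_lt_top.ne
  -- the event and the integrand
  set Ev : Set (Config (N + 1) (Fin 3) T3) := {w |
      ε ≤ ‖(Torus.geometry (Fin 3)).sepVec (w i).1 (w j).1‖ ∧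
        ‖(Torus.geometry (Fin 3)).sepVec (w i).1 (w j).1‖ ≤ r ((w i).2, (w j).2)} with hEv
  have hsepm : Measurable fun w : Config (N + 1) (Fin 3) T3 =>
      (Torus.geometry (Fin 3)).sepVec (w i).1 (w j).1 :=
    Torus.measurable_geometry_sepVec.comp ((measurable_pi_apply i).fst.prodMk (measurable_pi_apply j).fst)
  have hvm : Measurable fun w : Config (N + 1) (Fin 3) T3 => ((w i).2, (w j).2) :=
    (measurable_pi_apply i).snd.prodMk (measurable_pi_apply j).snd
  have hEvm : MeasurableSet Ev :=
    (measurableSet_le measurable_const hsepm.norm).inter (measurableSet_le hsepm.norm (hrm.comp hvm))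
  set F : Config (N + 1) (Fin 3) T3 → ℝ≥0∞ := Ev.indicator fun w => A ((w i).2, (w j).2) with hF
  have hFm : Measurable F := (hA.comp hvm).indicator hEvm
  -- the position event for fixed velocities, and its volume
  set T : (Fin (N + 1) → V3) → Set T3 := fun v =>
    {p | ε ≤ ‖Torus.reprSym p‖ ∧ ‖Torus.reprSym p‖ ≤ r (v i, v j)} with hT
  have hTm : ∀ v, MeasurableSet (T v) := fun v =>
    (measurableSet_le measurable_const Torus.measurable_reprSym.norm).inter
      (measurableSet_le Torus.measurable_reprSym.norm measurable_const)
  have hTvol : ∀ v, volume (T v) ≤ ENNReal.ofReal (r (v i, v j) ^ 3 - ε ^ 3) * c := fun v =>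
    volume_torusAnnulus_le hε0 (hr _)
  -- disintegrate the rung-0 law
  set Q := posGibbsMeasure (fun _ : T3 => a) ε (N + 1) with hQ
  set Γ : Measure (Fin (N + 1) → V3) := Measure.pi fun _ => gaussMeasure u θ with hΓ
  have hlaw : localGibbsLaw σ (fun _ => a) (fun _ => u) (fun _ => θ) N Φ = (Q.prod Γ).map zipConfig := by
    rw [localGibbsLaw_eq, localGibbsMeasure_rung0_eq_map σ ha.le hθ u N]
  haveI : IsProbabilityMeasure Q := isProbabilityMeasure_posGibbsMeasure continuous_const (fun _ => ha) hσ2 N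
  haveI : IsProbabilityMeasure Γ := by rw [hΓ]; infer_instance
  have hsec : ∀ v : Fin (N + 1) → V3,
      ∫⁻ x, F (zipConfig (x, v)) ∂Q ≤ A (v i, v j) * (4 * (ENNReal.ofReal (r (v i, v j) ^ 3 - ε ^ 3) * c)) := by
    intro v
    have hle : ∀ x, F (zipConfig (x, v)) ≤
        {x : Fin (N + 1) → T3 | x i - x j ∈ T v}.indicator (fun _ => A (v i, v j)) x := by
      intro x
      by_cases hx : zipConfig (x, v) ∈ Ev
      · have hx' : x ∈ {x : Fin (N + 1) → T3 | x i - x j ∈ T v} := by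
          simpa only [hEv, hT, mem_setOf_eq, zipConfig_apply, Torus.geometry_sepVec] using hx
        rw [hF, indicator_of_mem hx, indicator_of_mem hx']
        simp only [zipConfig_apply, le_refl]
      · rw [hF, indicator_of_notMem hx]
        exact bot_le
    calc ∫⁻ x, F (zipConfig (x, v)) ∂Q
        ≤ ∫⁻ x, {x : Fin (N + 1) → T3 | x i - x j ∈ T v}.indicator (fun _ => A (v i, v j)) x ∂Q :=
          lintegral_mono hle
      _ ≤ A (v i, v j) * Q {x | x i - x j ∈ T v} := lintegral_indicator_const_le _ _
      _ ≤ A (v i, v j) * (4 * volume (T v)) := by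
          have hQ' : Q {x | x i - x j ∈ T v} ≤ 4 * volume (T v) := by
            rw [hQ, posGibbsMeasure_const_eq_one ha]
            exact hpair _ (hTm v)
          gcongr
      _ ≤ A (v i, v j) * (4 * (ENNReal.ofReal (r (v i, v j) ^ 3 - ε ^ 3) * c)) := by
          gcongr
          exact hTvol v
  have hfm : Measurable fun p : V3 × V3 => A p * (4 * (ENNReal.ofReal (r p ^ 3 - ε ^ 3) * c)) :=
    hA.mul (measurable_const.mul
      ((ENNReal.measurable_ofReal.comp ((hrm.pow_const 3).sub measurable_const)).mul measurable_const))
  calc ∫⁻ w, F w ∂(localGibbsLaw σ (fun _ => a) (fun _ => u) (fun _ => θ) N Φ)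
      = ∫⁻ pr, F (zipConfig pr) ∂(Q.prod Γ) := by rw [hlaw, lintegral_map hFm measurable_zipConfig]
    _ = ∫⁻ v, ∫⁻ x, F (zipConfig (x, v)) ∂Q ∂Γ :=
        lintegral_prod_symm _ (hFm.comp measurable_zipConfig).aemeasurable
    _ ≤ ∫⁻ v, A (v i, v j) * (4 * (ENNReal.ofReal (r (v i, v j) ^ 3 - ε ^ 3) * c)) ∂Γ := lintegral_mono hsec
    _ = ∫⁻ p, A p * (4 * (ENNReal.ofReal (r p ^ 3 - ε ^ 3) * c)) ∂((gaussMeasure u θ).prod (gaussMeasure u θ)) := by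
        rw [hΓ]
        exact lintegral_pi_pair (gaussMeasure u θ) hij hfm
    _ = ∫⁻ p, (4 * c) * (ENNReal.ofReal (r p ^ 3 - ε ^ 3) * A p) ∂((gaussMeasure u θ).prod (gaussMeasure u θ)) := by
        refine lintegral_congr fun p => ?_
        ring
    _ = 4 * c * ∫⁻ p, ENNReal.ofReal (r p ^ 3 - ε ^ 3) * A p ∂((gaussMeasure u θ).prod (gaussMeasure u θ)) :=
        lintegral_const_mul' _ _ (ENNReal.mul_ne_top (by norm_num) hctop)

/-! ### The polynomial and moment estimates -/

/-- For `g ≥ 0` and `k ≤ 6`: `g ^ k ≤ 1 + g ^ 6`. [folklore] -/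
theorem pow_le_one_add_pow_six {g : ℝ} (hg : 0 ≤ g) {k : ℕ} (hk : k ≤ 6) : g ^ k ≤ 1 + g ^ 6 := by
  rcases le_total g 1 with h1 | h1
  · exact (pow_le_one₀ hg h1).trans (le_add_of_nonneg_right (by positivity))
  · exact (pow_le_pow_right₀ h1 hk).trans (le_add_of_nonneg_left zero_le_one)

/-- The polynomial estimate behind the shell bound: for `ε, h ≤ 1` and `g ≥ 0`,
`((ε + h g)³ − ε³)(1 + g³) ≤ ε² h · (3 g (1 + g³)) + h² · (8 (1 + g⁶))`
(`(ε + hg)³ − ε³ = 3ε²hg + 3εh²g² + h³g³`, `ε, h ≤ 1`, and `(3g² + g³)(1 + g³) ≤ 8(1 + g⁶)`). [folklore] -/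
theorem cube_sub_cube_mul_le {ε h g : ℝ} (hε1 : ε ≤ 1) (hh1 : h ≤ 1) (hg : 0 ≤ g) :
    ((ε + h * g) ^ 3 - ε ^ 3) * (1 + g ^ 3) ≤
      ε ^ 2 * h * (3 * g * (1 + g ^ 3)) + h ^ 2 * (8 * (1 + g ^ 6)) := by
  have e1 : (ε + h * g) ^ 3 - ε ^ 3 = ε ^ 2 * h * (3 * g) + h ^ 2 * (3 * ε * g ^ 2 + h * g ^ 3) := by ring
  have e2 : 3 * ε * g ^ 2 + h * g ^ 3 ≤ 3 * g ^ 2 + g ^ 3 := by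
    have h1 : ε * g ^ 2 ≤ g ^ 2 := mul_le_of_le_one_left (by positivity) hε1
    have h2 : h * g ^ 3 ≤ g ^ 3 := mul_le_of_le_one_left (by positivity) hh1
    linarith
  have e3 : (3 * g ^ 2 + g ^ 3) * (1 + g ^ 3) ≤ 8 * (1 + g ^ 6) := by
    have h2 := pow_le_one_add_pow_six hg (k := 2) (by norm_num)
    have h3 := pow_le_one_add_pow_six hg (k := 3) (by norm_num)
    have h5 := pow_le_one_add_pow_six hg (k := 5) (by norm_num)
    nlinarith [h2, h3, h5]
  have hg3 : 0 ≤ 1 + g ^ 3 := by positivity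
  rw [e1, add_mul]
  have step : h ^ 2 * (3 * ε * g ^ 2 + h * g ^ 3) * (1 + g ^ 3) ≤ h ^ 2 * (8 * (1 + g ^ 6)) := by
    calc h ^ 2 * (3 * ε * g ^ 2 + h * g ^ 3) * (1 + g ^ 3)
        = h ^ 2 * ((3 * ε * g ^ 2 + h * g ^ 3) * (1 + g ^ 3)) := by ring
      _ ≤ h ^ 2 * ((3 * g ^ 2 + g ^ 3) * (1 + g ^ 3)) := by
          refine mul_le_mul_of_nonneg_left (mul_le_mul_of_nonneg_right e2 hg3) (by positivity)
      _ ≤ h ^ 2 * (8 * (1 + g ^ 6)) := mul_le_mul_of_nonneg_left e3 (by positivity)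
  have step' : ε ^ 2 * h * (3 * g) * (1 + g ^ 3) = ε ^ 2 * h * (3 * g * (1 + g ^ 3)) := by ring
  linarith

/-- `4 + 512 ‖v‖⁶` is integrable under the Gaussian `N(u, θ)` (sixth Gaussian moments, Fernique). [folklore] -/
theorem integrable_const_add_norm_pow_six (u : V3) (θ : ℝ) :
    Integrable (fun v : V3 => 4 + 512 * ‖v‖ ^ 6) (gaussMeasure u θ) := by
  have h6 : Integrable (fun v : V3 => ‖v‖ ^ 6) (gaussMeasure u θ) := by
    have := (ProbabilityTheory.IsGaussian.memLp_id (gaussMeasure u θ) ((6 : ℕ) : ℝ≥0∞)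
      (by simp)).integrable_norm_pow (by norm_num)
    simpa using this
  exact (integrable_const 4).add (h6.const_mul 512)

/-- `8 (1 + ‖v − w‖⁶) ≤ (4 + 512 ‖v‖⁶) + (4 + 512 ‖w‖⁶)` (`‖v − w‖ ≤ 2 max(‖v‖, ‖w‖)`). [folklore] -/
theorem eight_mul_one_add_norm_sub_pow_six_le (v w : V3) :
    8 * (1 + ‖v - w‖ ^ 6) ≤ (4 + 512 * ‖v‖ ^ 6) + (4 + 512 * ‖w‖ ^ 6) := by
  have hvw : ‖v - w‖ ≤ ‖v‖ + ‖w‖ := norm_sub_le v w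
  rcases le_total ‖v‖ ‖w‖ with h | h
  · have h1 : ‖v - w‖ ≤ 2 * ‖w‖ := by linarith
    have h2 : ‖v - w‖ ^ 6 ≤ (2 * ‖w‖) ^ 6 := pow_le_pow_left₀ (norm_nonneg _) h1 6
    nlinarith [h2, pow_nonneg (norm_nonneg v) 6]
  · have h1 : ‖v - w‖ ≤ 2 * ‖v‖ := by linarith
    have h2 : ‖v - w‖ ^ 6 ≤ (2 * ‖v‖) ^ 6 := pow_le_pow_left₀ (norm_nonneg _) h1 6
    nlinarith [h2, pow_nonneg (norm_nonneg w) 6]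

/-- **The sextic Gaussian moment is finite**: `∫ 8 (1 + ‖v − w‖⁶) dN(u,θ)(v) dN(u,θ)(w) < ∞`. [folklore] -/
theorem lintegral_sexticMoment_ne_top (u : V3) (θ : ℝ) :
    ∫⁻ p, ENNReal.ofReal (8 * (1 + ‖p.1 - p.2‖ ^ 6)) ∂((gaussMeasure u θ).prod (gaussMeasure u θ)) ≠ ⊤ := by
  set γ := gaussMeasure u θ with hγ
  set g : V3 → ℝ := fun v => 4 + 512 * ‖v‖ ^ 6 with hg
  have hg0 : ∀ v, 0 ≤ g v := fun v => by rw [hg]; positivity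
  have hgi : Integrable g γ := integrable_const_add_norm_pow_six u θ
  have hgm : Measurable fun v : V3 => ENNReal.ofReal (g v) := by rw [hg]; fun_prop
  have hle : ∀ p : V3 × V3, ENNReal.ofReal (8 * (1 + ‖p.1 - p.2‖ ^ 6)) ≤
      ENNReal.ofReal (g p.1) + ENNReal.ofReal (g p.2) := by
    intro p
    rw [← ENNReal.ofReal_add (hg0 p.1) (hg0 p.2)]
    exact ENNReal.ofReal_le_ofReal (eight_mul_one_add_norm_sub_pow_six_le p.1 p.2)
  have h1 : ∫⁻ p, ENNReal.ofReal (g p.1) ∂(γ.prod γ) = ∫⁻ v, ENNReal.ofReal (g v) ∂γ := by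
    calc ∫⁻ p, ENNReal.ofReal (g p.1) ∂(γ.prod γ)
        = ∫⁻ v, ∫⁻ _w, ENNReal.ofReal (g v) ∂γ ∂γ := lintegral_prod _ (hgm.comp measurable_fst).aemeasurable
      _ = ∫⁻ v, ENNReal.ofReal (g v) ∂γ := by simp only [lintegral_const, measure_univ, mul_one]
  have h2 : ∫⁻ p, ENNReal.ofReal (g p.2) ∂(γ.prod γ) = ∫⁻ v, ENNReal.ofReal (g v) ∂γ := by
    calc ∫⁻ p, ENNReal.ofReal (g p.2) ∂(γ.prod γ)
        = ∫⁻ _v, ∫⁻ w, ENNReal.ofReal (g w) ∂γ ∂γ := lintegral_prod _ (hgm.comp measurable_snd).aemeasurable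
      _ = ∫⁻ v, ENNReal.ofReal (g v) ∂γ := by simp only [lintegral_const, measure_univ, mul_one]
  have hfin : ∫⁻ v, ENNReal.ofReal (g v) ∂γ < ⊤ := hgi.lintegral_lt_top
  refine ne_of_lt ?_
  calc ∫⁻ p, ENNReal.ofReal (8 * (1 + ‖p.1 - p.2‖ ^ 6)) ∂(γ.prod γ)
      ≤ ∫⁻ p, (ENNReal.ofReal (g p.1) + ENNReal.ofReal (g p.2)) ∂(γ.prod γ) := lintegral_mono hle
    _ = ∫⁻ v, ENNReal.ofReal (g v) ∂γ + ∫⁻ v, ENNReal.ofReal (g v) ∂γ := by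
        rw [lintegral_add_left (show Measurable (fun p : V3 × V3 => ENNReal.ofReal (g p.1)) from
          hgm.comp measurable_fst), h1, h2]
    _ < ⊤ := ENNReal.add_lt_top.2 ⟨hfin, hfin⟩

/-- The tripled flux-weighted cubic moment `∫ 3 ‖v − w‖ (1 + ‖v − w‖³) dN dN` is finite. [folklore] -/
theorem lintegral_cubicFluxMoment3_ne_top (u : V3) (θ : ℝ) :
    ∫⁻ p, ENNReal.ofReal (3 * ‖p.1 - p.2‖ * (1 + ‖p.1 - p.2‖ ^ 3))
        ∂((gaussMeasure u θ).prod (gaussMeasure u θ)) ≠ ⊤ := by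
  have h := lintegral_cubicFluxMoment_ne_top u θ
  have heq : ∀ p : V3 × V3, ENNReal.ofReal (3 * ‖p.1 - p.2‖ * (1 + ‖p.1 - p.2‖ ^ 3)) =
      3 * (ENNReal.ofReal ‖p.2 - p.1‖ * ENNReal.ofReal (1 + ‖p.1 - p.2‖ ^ 3)) := by
    intro p
    rw [norm_sub_rev p.2 p.1, ← ENNReal.ofReal_mul (norm_nonneg _), ← ENNReal.ofReal_ofNat 3,
      ← ENNReal.ofReal_mul (by norm_num)]
    congr 1
    ring
  simp_rw [heq]
  rw [lintegral_const_mul' _ _ (by norm_num)]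
  exact ENNReal.mul_ne_top (by norm_num) h

/-! ### The evolved shell bound at rung 0 -/

/-- **The hypothesis of `collisionMomentBound_of_shellFluxBound` holds for constant profiles, uniformly in `N`.**
For `a, θ > 0`, `u` there is `σ₀ > 0` such that for `0 < σ < σ₀` and every flow family `Φ` there is `A` with, for
every `N`, some `B` (here both independent of `N` and `σ`:
`A = 4 vol B₁ ∫ 3|g|(1+|g|³)`, `B = 4 vol B₁ ∫ 8(1+|g|⁶)` over `N(u,θ) ⊗ N(u,θ)`) such that for all `h ∈ (0, 1]`,
all times `s` and all `i ≠ j`,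
`∫ 𝟙{‖xᵢ − xⱼ‖_{𝕋³} ≤ ε_N + h ‖vᵢ − vⱼ‖}(Φ_s z) (1 + ‖vᵢ − vⱼ‖³)(Φ_s z) dG_N(z) ≤ A ε_N² h + B h²`,
`G_N = localGibbsLaw σ a u θ N (Φ N)`: invariance of `G_N`, a.e. non-overlap (`ε_N ≤ ‖xᵢ − xⱼ‖`), the static annulus
bound `lintegral_annulusIndicator_le` at small density (`posGibbs_pairEvent_le`), and `cube_sub_cube_mul_le`.
[folklore] -/
theorem shellFluxBound_const {a θ : ℝ} (ha : 0 < a) (hθ : 0 < θ) (u : V3) :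
    ∃ σ₀ : ℝ, 0 < σ₀ ∧ ∀ σ : ℝ, 0 < σ → σ < σ₀ →
      ∀ Φ : (N : ℕ) → HardSphereFlow (Torus.geometry (Fin 3)) (hsDiameter σ N) (N + 1),
      ∃ A : ℝ, ∀ N : ℕ, ∃ B : ℝ, ∀ h ∈ Ioc (0 : ℝ) 1, ∀ s : ℝ, ∀ i j : Fin (N + 1), i ≠ j →
        ∫⁻ z, {w : Config (N + 1) (Fin 3) T3 |
            ‖(Torus.geometry (Fin 3)).sepVec (w i).1 (w j).1‖ ≤
              hsDiameter σ N + h * ‖(w i).2 - (w j).2‖}.indicator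
            (fun w => ENNReal.ofReal (1 + ‖(w i).2 - (w j).2‖ ^ 3)) ((Φ N).flow s z)
          ∂(localGibbsLaw σ (fun _ => a) (fun _ => u) (fun _ => θ) N (Φ N)) ≤
        ENNReal.ofReal (A * hsDiameter σ N ^ 2 * h + B * h ^ 2) := by
  obtain ⟨σ₀, hσ₀, hsmall⟩ := exists_smallDensity uniformProfile one_pos
  refine ⟨σ₀, hσ₀, fun σ hσ hσlt Φ => ?_⟩
  have hsm : SmallDensity uniformProfile σ := (hsmall σ hσ hσlt).1
  have hσ2 : σ ≤ 1 / 2 := hsm.σ_lt_half.le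
  -- the two Gaussian moments and the constants
  set γ2 := (gaussMeasure u θ).prod (gaussMeasure u θ) with hγ2
  set I₁ : ℝ≥0∞ := ∫⁻ p, ENNReal.ofReal (3 * ‖p.1 - p.2‖ * (1 + ‖p.1 - p.2‖ ^ 3)) ∂γ2 with hI₁
  set I₂ : ℝ≥0∞ := ∫⁻ p, ENNReal.ofReal (8 * (1 + ‖p.1 - p.2‖ ^ 6)) ∂γ2 with hI₂
  have hI₁top : I₁ ≠ ⊤ := lintegral_cubicFluxMoment3_ne_top u θ
  have hI₂top : I₂ ≠ ⊤ := lintegral_sexticMoment_ne_top u θ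
  set c : ℝ≥0∞ := volume (Metric.ball (0 : V3) 1) with hc
  have hctop : c ≠ ⊤ := measure_ball_lt_top.ne
  refine ⟨4 * c.toReal * I₁.toReal, fun N => ⟨4 * c.toReal * I₂.toReal, fun h hh s i j hij => ?_⟩⟩
  have hh0 : 0 < h := hh.1
  set ε := hsDiameter σ N with hεdef
  have hε0 : 0 ≤ ε := (hsDiameter_pos hσ N).le
  have hε1 : ε ≤ 1 := (hsDiameter_le hσ.le N).trans (by linarith [hsm.σ_lt_half])
  set P := localGibbsLaw σ (fun _ => a) (fun _ => u) (fun _ => θ) N (Φ N) with hP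
  rcases Nat.eq_zero_or_pos N with rfl | hNpos
  · exact absurd (Fin.ext (by have := i.2; have := j.2; omega)) hij
  have hN : 1 ≤ N := hNpos
  -- the integrand, its measurability, invariance of `G_N` under `Φ_s`; then a.e. non-overlap
  set b : V3 × V3 → ℝ≥0∞ := fun p => ENNReal.ofReal (1 + ‖p.1 - p.2‖ ^ 3) with hb
  have hbm : Measurable b := by rw [hb]; fun_prop
  set E : Set (Config (N + 1) (Fin 3) T3) := {w |
      ‖(Torus.geometry (Fin 3)).sepVec (w i).1 (w j).1‖ ≤ ε + h * ‖(w i).2 - (w j).2‖} with hE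
  have hsepm : Measurable fun w : Config (N + 1) (Fin 3) T3 =>
      (Torus.geometry (Fin 3)).sepVec (w i).1 (w j).1 :=
    Torus.measurable_geometry_sepVec.comp ((measurable_pi_apply i).fst.prodMk (measurable_pi_apply j).fst)
  have hvm : Measurable fun w : Config (N + 1) (Fin 3) T3 => ((w i).2, (w j).2) :=
    (measurable_pi_apply i).snd.prodMk (measurable_pi_apply j).snd
  have hgm : Measurable fun w : Config (N + 1) (Fin 3) T3 => ‖(w i).2 - (w j).2‖ :=
    ((measurable_pi_apply i).snd.sub (measurable_pi_apply j).snd).norm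
  have hEm : MeasurableSet E := measurableSet_le hsepm.norm (measurable_const.add (measurable_const.mul hgm))
  set F : Config (N + 1) (Fin 3) T3 → ℝ≥0∞ := E.indicator fun w => b ((w i).2, (w j).2) with hF
  have hFm : Measurable F := (hbm.comp hvm).indicator hEm
  have hstat := measurePreserving_flow_localGibbsLaw_const σ a θ u N (Φ N) s
  have hinv : ∫⁻ z, F ((Φ N).flow s z) ∂P = ∫⁻ z, F z ∂P := hstat.lintegral_comp hFm
  set Ev : Set (Config (N + 1) (Fin 3) T3) := {w |
      ε ≤ ‖(Torus.geometry (Fin 3)).sepVec (w i).1 (w j).1‖ ∧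
        ‖(Torus.geometry (Fin 3)).sepVec (w i).1 (w j).1‖ ≤ ε + h * ‖(w i).2 - (w j).2‖} with hEv
  have hDm : MeasurableSet (hardSphereDomain (Torus.geometry (Fin 3)) (N + 1) ε) :=
    measurableSet_hardSphereDomain _ Torus.measurable_geometry_sepVec _ _
  have haeD : ∀ᵐ w ∂P, w ∈ hardSphereDomain (Torus.geometry (Fin 3)) (N + 1) ε := by
    have hac : P ≪ liouville (Torus.geometry (Fin 3)) (N + 1) ε := by
      rw [hP, localGibbsLaw_eq]
      exact localGibbsMeasure_absolutelyContinuous σ _ _ _ N (Φ N)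
    exact hac.ae_le (ae_restrict_mem hDm)
  have hFle : ∀ᵐ w ∂P, F w ≤ Ev.indicator (fun w => b ((w i).2, (w j).2)) w := by
    filter_upwards [haeD] with w hw
    by_cases hwE : w ∈ E
    · have hwEv : w ∈ Ev := ⟨hw i j hij, hwE⟩
      rw [hF, indicator_of_mem hwE, indicator_of_mem hwEv]
    · rw [hF, indicator_of_notMem hwE]
      exact zero_le
  -- the static bound for the annulus event
  have hr : ∀ p : V3 × V3, ε ≤ ε + h * ‖p.1 - p.2‖ := fun p =>
    le_add_of_nonneg_right (mul_nonneg hh.1.le (norm_nonneg _))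
  have hstatic := lintegral_annulusIndicator_le hσ2 hσ.le ha hθ u hij
    (fun T hT => posGibbs_pairEvent_le hsm hN hij hT) (Φ N)
    (r := fun p => ε + h * ‖p.1 - p.2‖) (by fun_prop) hr hbm
  -- the polynomial estimate inside the Gaussian integral
  have hpoly : ∀ p : V3 × V3, ENNReal.ofReal ((ε + h * ‖p.1 - p.2‖) ^ 3 - ε ^ 3) * b p ≤
      ENNReal.ofReal (ε ^ 2 * h) * ENNReal.ofReal (3 * ‖p.1 - p.2‖ * (1 + ‖p.1 - p.2‖ ^ 3)) +
        ENNReal.ofReal (h ^ 2) * ENNReal.ofReal (8 * (1 + ‖p.1 - p.2‖ ^ 6)) := by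
    intro p
    have hg := norm_nonneg (p.1 - p.2)
    have hcube : 0 ≤ (ε + h * ‖p.1 - p.2‖) ^ 3 - ε ^ 3 :=
      sub_nonneg.2 (pow_le_pow_left₀ hε0 (hr p) 3)
    rw [hb, ← ENNReal.ofReal_mul hcube, ← ENNReal.ofReal_mul (by positivity),
      ← ENNReal.ofReal_mul (by positivity), ← ENNReal.ofReal_add (by positivity) (by positivity)]
    refine ENNReal.ofReal_le_ofReal ?_
    have := cube_sub_cube_mul_le hε1 hh.2 hg
    nlinarith [this]
  have hm1 : Measurable fun p : V3 × V3 =>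
      ENNReal.ofReal (ε ^ 2 * h) * ENNReal.ofReal (3 * ‖p.1 - p.2‖ * (1 + ‖p.1 - p.2‖ ^ 3)) := by
    fun_prop
  have hint : ∫⁻ p, ENNReal.ofReal ((ε + h * ‖p.1 - p.2‖) ^ 3 - ε ^ 3) * b p ∂γ2 ≤
      ENNReal.ofReal (ε ^ 2 * h) * I₁ + ENNReal.ofReal (h ^ 2) * I₂ := by
    calc ∫⁻ p, ENNReal.ofReal ((ε + h * ‖p.1 - p.2‖) ^ 3 - ε ^ 3) * b p ∂γ2
        ≤ ∫⁻ p, (ENNReal.ofReal (ε ^ 2 * h) * ENNReal.ofReal (3 * ‖p.1 - p.2‖ * (1 + ‖p.1 - p.2‖ ^ 3)) +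
            ENNReal.ofReal (h ^ 2) * ENNReal.ofReal (8 * (1 + ‖p.1 - p.2‖ ^ 6))) ∂γ2 :=
          lintegral_mono hpoly
      _ = ENNReal.ofReal (ε ^ 2 * h) * I₁ + ENNReal.ofReal (h ^ 2) * I₂ := by
          rw [lintegral_add_left hm1, lintegral_const_mul' _ _ ENNReal.ofReal_ne_top,
            lintegral_const_mul' _ _ ENNReal.ofReal_ne_top]
  have hIeq₁ : I₁ = ENNReal.ofReal I₁.toReal := (ENNReal.ofReal_toReal hI₁top).symm
  have hIeq₂ : I₂ = ENNReal.ofReal I₂.toReal := (ENNReal.ofReal_toReal hI₂top).symm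
  have hceq : c = ENNReal.ofReal c.toReal := (ENNReal.ofReal_toReal hctop).symm
  calc ∫⁻ z, F ((Φ N).flow s z) ∂P = ∫⁻ z, F z ∂P := hinv
    _ ≤ ∫⁻ w, Ev.indicator (fun w => b ((w i).2, (w j).2)) w ∂P := lintegral_mono_ae hFle
    _ ≤ 4 * c * ∫⁻ p, ENNReal.ofReal ((ε + h * ‖p.1 - p.2‖) ^ 3 - ε ^ 3) * b p ∂γ2 := hstatic
    _ ≤ 4 * c * (ENNReal.ofReal (ε ^ 2 * h) * I₁ + ENNReal.ofReal (h ^ 2) * I₂) := mul_le_mul' le_rfl hint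
    _ = ENNReal.ofReal (4 * c.toReal * I₁.toReal * ε ^ 2 * h + 4 * c.toReal * I₂.toReal * h ^ 2) := by
        rw [hIeq₁, hIeq₂, hceq, ENNReal.toReal_ofReal ENNReal.toReal_nonneg,
          ENNReal.toReal_ofReal ENNReal.toReal_nonneg, ENNReal.toReal_ofReal ENNReal.toReal_nonneg,
          ← ENNReal.ofReal_ofNat 4, ← ENNReal.ofReal_mul (by norm_num),
          ← ENNReal.ofReal_mul (by positivity), ← ENNReal.ofReal_mul (by positivity),
          ← ENNReal.ofReal_add (by positivity) (by positivity), ← ENNReal.ofReal_mul (by positivity)]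
        congr 1
        ring

end Summit.AtomisticToContinuum.HydrodynamicLimit.Theorems.LambertianContactSwapCollisionMomentBound

end
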